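import Literature.Geometry.Kaehler.LocalPQForms
import Literature.Geometry.Kaehler.ChartTransport
import Literature.Geometry.Kaehler.ManifoldFormsPullback
import Literature.Analysis.Complex.DolbeaultInvariance
import Literature.NumberTheory.Transcendental.DolbeaultConvexProofs
import HarnessLib

/-!
# Chart sets of convex opens are `∂̄`-acyclic (the `∂̄`-Poincaré lemma transported into a complex manifold)

For a complex manifold `M` modelled on the finite-dimensional complex normed space `E` and a
point `x₀`, the **chart set** `chartSet 𝓘(ℝ, E) x₀ C ⊆ M` of an open convex `C ⊆ E` contained in
the target of the chart at `x₀` is biholomorphic, through that chart, to the open submanifold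
`C` of `E`, whose Dolbeault cohomology vanishes in bidegrees `(p, ≥ 1)` by the tree's
`∂̄`-Poincaré lemma on convex opens
(`Literature.NumberTheory.Transcendental.subsingleton_dolbeaultCohomology_of_convex_holds`,
Hörmander (1973), Thm. 2.7.8 / Voisin (2002), Prop. 2.36). Hence (biholomorphic invariance,
`Literature.Analysis.Complex.subsingleton_dolbeaultCohomology_of_leftInverse`) the open
submanifold `chartSet x₀ C` has `H^{p,q+1}_{∂̄} = 0`, and — this is the content of the present
file — so does `chartSet x₀ C` in the language of `LocalPQForms` (forms on `M` smooth on the open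
set and zero off it): **`isDolbeaultAcyclic_chartSet`**. These are the acyclic finite
intersections of the Leray covers in the Čech proof of the Cartan–Serre finiteness theorem
(Griffiths–Harris (1978), p. 45: "by the `∂̄`-Poincaré lemma the columns are exact").

The bridge between the two languages (forms on the open submanifold `↥U` and forms on `M`
vanishing off `U`):

* `opensRetract U w₀ : M → ↥U` (the identity on `U`, junk elsewhere), `C^∞` with identity
  differential at the points of `U`; `MForm.extendOpens` — extension by zero of a form on `↥U` to
  `M` as the pull-back along `opensRetract`, cut off to `U`; it is smooth at the points of `U`,
  keeps the type, and restricts back to the form (`pullback_subtypeVal_extendOpens`);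
* `dolbeaultBar_pullback_subtypeVal_apply` — `∂̄(γ|_U) w = ∂̄γ w` for a `(p,q)`-form `γ` on `U`
  in the sense of `pqFormsOn` (localisation by bumps + the tree's naturality of `∂̄` for the
  holomorphic inclusion `↥U → M`);
* `isDolbeaultAcyclic_of_subsingleton` — `H^{p,q+1}_{∂̄}(↥U) = 0` for all `q` implies
  `IsDolbeaultAcyclic E M U.isOpen p`;
* `subsingleton_dolbeaultCohomology_chartSet`, `isDolbeaultAcyclic_chartSet`.

Everything is proved; no named facts.

## References

* P. Griffiths, J. Harris, *Principles of Algebraic Geometry* (1978), p. 25 (`∂̄`-Poincaré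
  lemma), p. 45. [GriffithsHarris1978]
* C. Voisin, *Hodge Theory and Complex Algebraic Geometry I* (2002), Prop. 2.36, §7.3.2.
  [VoisinHodgeI2002]
* L. Hörmander, *An Introduction to Complex Analysis in Several Variables* (1973), Thm. 2.7.8.
  [HormanderSCV1973]
-/

noncomputable section

open scoped Manifold ContDiff Topology
open Set Filter Function TopologicalSpace Literature.NumberTheory.Transcendental
  Literature.Analysis.Complex

namespace Literature.Geometry.Kaehler

variable {E : Type*} [NormedAddCommGroup E] [NormedSpace ℂ E]
  {M : Type*} [TopologicalSpace M] [ChartedSpace E M]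

/-! ### The retraction onto an open submanifold -/

section Retract

variable {U : Opens M} {w₀ : U}

variable (U w₀) in
open Classical in
/-- The map `M → ↥U` which is the identity on `U` (and the constant `w₀` off `U`). [folklore] -/
def opensRetract (m : M) : U := if h : m ∈ U then ⟨m, h⟩ else w₀

/-- On `U` the retraction is the identity. [folklore] -/
theorem opensRetract_of_mem {m : M} (hm : m ∈ U) : opensRetract U w₀ m = ⟨m, hm⟩ := by
  unfold opensRetract
  rw [dif_pos hm]

/-- On `U` the retraction is the identity (valued form). [folklore] -/
theorem val_opensRetract_of_mem {m : M} (hm : m ∈ U) : (opensRetract U w₀ m : M) = m := by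
  rw [opensRetract_of_mem hm]

/-- `opensRetract ∘ Subtype.val = id`. [folklore] -/
@[simp]
theorem opensRetract_val (w : U) : opensRetract U w₀ (w : M) = w :=
  Subtype.ext (val_opensRetract_of_mem w.2)

/-- Near a point of `U`, `Subtype.val ∘ opensRetract = id`. [folklore] -/
theorem val_comp_opensRetract_eventuallyEq {m : M} (hm : m ∈ U) :
    (Subtype.val ∘ opensRetract U w₀) =ᶠ[𝓝 m] id := by
  filter_upwards [U.isOpen.mem_nhds hm] with z hz
  exact val_opensRetract_of_mem hz

omit [NormedSpace ℂ E] in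
/-- The retraction is `C^∞` at the points of `U` (for any model structure on `M` carried by the
charts into `E`: the composite with the inclusion is the identity near the point, and Mathlib's
`ContMDiffWithinAt.subtypeVal_comp_iff`). [folklore] -/
theorem contMDiffAt_opensRetract {𝕜 : Type*} [NontriviallyNormedField 𝕜] [NormedSpace 𝕜 E]
    {m : M} (hm : m ∈ U) : ContMDiffAt 𝓘(𝕜, E) 𝓘(𝕜, E) ∞ (opensRetract U w₀) m := by
  have h : ContMDiffWithinAt 𝓘(𝕜, E) 𝓘(𝕜, E) ∞ (Subtype.val ∘ opensRetract U w₀) univ m :=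
    (contMDiffAt_id.congr_of_eventuallyEq (val_comp_opensRetract_eventuallyEq hm)).contMDiffWithinAt
  exact ((ContMDiffWithinAt.subtypeVal_comp_iff U (opensRetract U w₀) univ m).1 h).contMDiffAt
    univ_mem

/-- The retraction is `C^∞` near every point of `U`. [folklore] -/
theorem eventually_contMDiffAt_opensRetract {m : M} (hm : m ∈ U) :
    ∀ᶠ z in 𝓝 m, ContMDiffAt 𝓘(ℝ, E) 𝓘(ℝ, E) ∞ (opensRetract U w₀) z := by
  filter_upwards [U.isOpen.mem_nhds hm] with z hz
  exact contMDiffAt_opensRetract hz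

/-- **The retraction has identity differential at the points of `U`** (the inclusion has
identity differential and `val ∘ retract = id` near the point). [folklore] -/
theorem mfderiv_opensRetract {m : M} (hm : m ∈ U) :
    mfderiv 𝓘(ℝ, E) 𝓘(ℝ, E) (opensRetract U w₀) m = ContinuousLinearMap.id ℝ E := by
  have hr : MDifferentiableAt 𝓘(ℝ, E) 𝓘(ℝ, E) (opensRetract U w₀) m :=
    (contMDiffAt_opensRetract hm).mdifferentiableAt (by simp)
  have hval : HasMFDerivAt 𝓘(ℝ, E) 𝓘(ℝ, E) (Subtype.val : U → M) (opensRetract U w₀ m)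
      (ContinuousLinearMap.id ℝ E) :=
    Literature.Geometry.Manifold.OpenSubmanifold.hasMFDerivAt_subtype_val _
  have hcomp : HasMFDerivAt 𝓘(ℝ, E) 𝓘(ℝ, E) (Subtype.val ∘ opensRetract U w₀) m
      ((ContinuousLinearMap.id ℝ E).comp (mfderiv 𝓘(ℝ, E) 𝓘(ℝ, E) (opensRetract U w₀) m)) :=
    hval.comp m hr.hasMFDerivAt
  have hid : HasMFDerivAt 𝓘(ℝ, E) 𝓘(ℝ, E) (Subtype.val ∘ opensRetract U w₀) m
      (ContinuousLinearMap.id ℝ (TangentSpace 𝓘(ℝ, E) m)) :=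
    (hasMFDerivAt_id m).congr_of_eventuallyEq (val_comp_opensRetract_eventuallyEq hm)
  have h := hcomp.mfderiv.symm.trans hid.mfderiv
  rw [ContinuousLinearMap.id_comp] at h
  exact h

end Retract

/-! ### Extension by zero of forms on an open submanifold -/

section Extend

variable {U : Opens M} {w₀ : U} {k : ℕ}

/-- **Extension by zero** of a form on the open submanifold `↥U` to a form on `M`: the pull-back
along the retraction, cut off to `U`. [folklore] -/
def MForm.extendOpens (β : MForm 𝓘(ℝ, E) U ℂ k) (w₀ : U) : MForm 𝓘(ℝ, E) M ℂ k :=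
  (β.pullback 𝓘(ℝ, E) (opensRetract U w₀)).restr (U : Set M)

/-- At a point of `U` the extension is the form (`T_m U = T_m M` and the retraction has identity
differential). [folklore] -/
theorem MForm.extendOpens_apply_of_mem (β : MForm 𝓘(ℝ, E) U ℂ k) {m : M} (hm : m ∈ U)
    (v : Fin k → TangentSpace 𝓘(ℝ, E) m) :
    β.extendOpens w₀ m v = β ⟨m, hm⟩ v := by
  rw [MForm.extendOpens, MForm.restr_apply_of_mem _ hm, MForm.pullback_apply, mfderiv_opensRetract hm,
    opensRetract_of_mem hm]
  rfl

/-- Off `U` the extension vanishes. [folklore] -/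
theorem MForm.extendOpens_apply_of_notMem (β : MForm 𝓘(ℝ, E) U ℂ k) {m : M} (hm : m ∉ (U : Set M)) :
    β.extendOpens w₀ m = 0 :=
  MForm.restr_apply_of_notMem _ hm

/-- **Restricting the extension back to `↥U` gives the form.** [folklore] -/
theorem MForm.pullback_subtypeVal_extendOpens (β : MForm 𝓘(ℝ, E) U ℂ k) :
    (β.extendOpens w₀).pullback 𝓘(ℝ, E) (Subtype.val : U → M) = β := by
  funext w
  ext v
  rw [MForm.pullback_subtypeVal_apply, MForm.extendOpens_apply_of_mem β w.2]

/-- The extension keeps the type. [folklore] -/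
theorem _root_.Literature.NumberTheory.Transcendental.IsOfType.extendOpens {p q : ℕ}
    {β : MForm 𝓘(ℝ, E) U ℂ k} (hβ : IsOfType p q β) : IsOfType p q (β.extendOpens w₀) := by
  refine ⟨hβ.1, fun m θ v ↦ ?_⟩
  by_cases hm : m ∈ U
  · rw [MForm.extendOpens_apply_of_mem β hm, MForm.extendOpens_apply_of_mem β hm]
    exact hβ.2 ⟨m, hm⟩ θ v
  · have h0 : β.extendOpens w₀ m = 0 := MForm.extendOpens_apply_of_notMem β hm
    simp [h0]

variable [IsManifold 𝓘(ℝ, E) ∞ M]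

/-- The extension is smooth at the points of `U` where the form is. [folklore] -/
theorem MForm.smoothAt_extendOpens {β : MForm 𝓘(ℝ, E) U ℂ k} {m : M} (hm : m ∈ U)
    (hβ : β.SmoothAt ⟨m, hm⟩) : (β.extendOpens w₀).SmoothAt m := by
  refine (MForm.smoothAt_restr_iff U.isOpen _ hm).2 ?_
  refine MForm.SmoothAt.pullback (eventually_contMDiffAt_opensRetract hm) ?_
  rwa [opensRetract_of_mem hm]

/-- **The extension of a smooth `(p,q)`-form on `↥U` is a `(p,q)`-form on `U`** in the sense of
`pqFormsOn`. [folklore] -/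
theorem extendOpens_mem_pqFormsOn {p q : ℕ} {β : MForm 𝓘(ℝ, E) U ℂ (p + q)}
    (hβ : β ∈ pqForms E U p q) : β.extendOpens w₀ ∈ pqFormsOn E M (U : Set M) p q := by
  obtain ⟨hs, ht⟩ := (mem_pqForms_iff β).1 hβ
  exact ⟨fun m hm ↦ MForm.smoothAt_extendOpens hm (hs ⟨m, hm⟩), fun m hm ↦ MForm.extendOpens_apply_of_notMem β hm,
    ht.extendOpens⟩

end Extend

/-! ### `∂̄` and the restriction to an open submanifold -/

section DbarVal

variable [FiniteDimensional ℂ E] [T2Space M] [IsManifold 𝓘(ℂ, E) ω M] [IsManifold 𝓘(ℝ, E) ∞ M]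
  {U : Opens M} {p q : ℕ}

omit [FiniteDimensional ℂ E] [T2Space M] [IsManifold 𝓘(ℂ, E) ω M] [IsManifold 𝓘(ℝ, E) ∞ M] in
/-- The inclusion of an open submanifold is holomorphic. [folklore] -/
theorem mdifferentiable_complex_subtype_val : MDifferentiable 𝓘(ℂ, E) 𝓘(ℂ, E) (Subtype.val : U → M) :=
  (contMDiff_subtype_val (I := 𝓘(ℂ, E)) (n := ∞)).mdifferentiable (by simp)

omit [FiniteDimensional ℂ E] [T2Space M] [IsManifold 𝓘(ℂ, E) ω M] [IsManifold 𝓘(ℝ, E) ∞ M] in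
/-- The inclusion of an open submanifold is real-`C^∞`. [folklore] -/
theorem contMDiff_real_subtype_val : ContMDiff 𝓘(ℝ, E) 𝓘(ℝ, E) ∞ (Subtype.val : U → M) :=
  contMDiff_subtype_val

omit [IsManifold 𝓘(ℂ, E) ω M] in
/-- **`∂̄` commutes with the restriction to an open submanifold**, pointwise, for a `(p,q)`-form on
`U` in the sense of `pqFormsOn`: `∂̄(γ|_U) w = ∂̄γ w` (localise `γ` near `↑w` to a globally smooth
form of the same type and use the naturality of `∂̄` for the holomorphic inclusion,
`dolbeaultBar_pullback_of_isOfType`). [cite: VoisinHodgeI2002, §2.3.3] -/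
theorem dolbeaultBar_pullback_subtypeVal_apply {γ : MForm 𝓘(ℝ, E) M ℂ (p + q)}
    (hγ : γ ∈ pqFormsOn E M (U : Set M) p q) (w : U) :
    dolbeaultBar (γ.pullback 𝓘(ℝ, E) (Subtype.val : U → M)) w = dolbeaultBar γ (w : M) := by
  obtain ⟨γ', hγ's, hγ't, hγ'⟩ := exists_smooth_eventuallyEq U.isOpen hγ w.2
  -- the restrictions agree near `w`
  have hev : ∀ᶠ z in 𝓝 w, (γ'.pullback 𝓘(ℝ, E) (Subtype.val : U → M)) z =
      (γ.pullback 𝓘(ℝ, E) (Subtype.val : U → M)) z := by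
    filter_upwards [continuous_subtype_val.continuousAt.eventually hγ'] with z hz
    ext v
    rw [MForm.pullback_subtypeVal_apply, MForm.pullback_subtypeVal_apply, hz]
  rw [← dolbeaultBar_congr_of_eventuallyEq hev,
    dolbeaultBar_pullback_of_isOfType hγ't hγ's mdifferentiable_complex_subtype_val contMDiff_real_subtype_val,
    ← dolbeaultBar_congr_of_eventuallyEq hγ']
  exact ContinuousAlternatingMap.ext fun v ↦ MForm.pullback_subtypeVal_apply _ w v

end DbarVal

/-! ### Acyclicity in the language of `LocalPQForms` -/

section Acyclic

variable [FiniteDimensional ℂ E] [T2Space M] [IsManifold 𝓘(ℂ, E) ω M] [IsManifold 𝓘(ℝ, E) ∞ M]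

/-- **`H^{p,q+1}_{∂̄}(↥U) = 0` for all `q` implies the `∂̄`-acyclicity of `U` in the sense of
`IsDolbeaultAcyclic`**: a `∂̄_U`-closed `(p,q+1)`-form `α` on `U` (form on `M`, zero off `U`)
restricts to a `∂̄`-closed smooth form on the open submanifold `↥U`, which is `∂̄β'` for a smooth
`(p,q)`-form `β'` on `↥U`; the extension by zero `β` of `β'` has `∂̄_U β = α`. [folklore] -/
theorem isDolbeaultAcyclic_of_subsingleton {U : Opens M} (p : ℕ)
    (hU : ∀ q : ℕ, Subsingleton (dolbeaultCohomology E U p (q + 1))) :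
    IsDolbeaultAcyclic E M U.isOpen p := by
  intro q α hα
  -- `∂̄α = 0` at the points of `U`
  have hα0 : ∀ m ∈ (U : Set M), dolbeaultBar (α : MForm 𝓘(ℝ, E) M ℂ (p + (q + 1))) m = 0 := by
    intro m hm
    have h := congrArg (fun γ : ↥(pqFormsOn E M (U : Set M) p (q + 1 + 1)) ↦
      (γ : MForm 𝓘(ℝ, E) M ℂ (p + (q + 1 + 1))) m) hα
    simp only [coe_localDbar, MForm.restr_apply_of_mem _ hm, ZeroMemClass.coe_zero, Pi.zero_apply] at h
    exact h
  by_cases hne : (U : Set M).Nonempty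
  swap
  · -- `U = ∅`: `α = 0`
    refine ⟨0, ?_⟩
    rw [map_zero]
    symm
    apply Subtype.ext
    funext m
    have hm : m ∉ (U : Set M) := fun h ↦ hne ⟨m, h⟩
    exact α.2.2.1 m hm
  obtain ⟨m₀, hm₀⟩ := hne
  let w₀ : U := ⟨m₀, hm₀⟩
  -- the restriction of `α` to `↥U` is `∂̄`-closed, smooth, of type `(p,q+1)`
  set α' : MForm 𝓘(ℝ, E) U ℂ (p + (q + 1)) :=
    (α : MForm 𝓘(ℝ, E) M ℂ (p + (q + 1))).pullback 𝓘(ℝ, E) (Subtype.val : U → M) with hα'def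
  have hα's : IsSmoothForm α' := fun w ↦ MForm.SmoothAt.pullback_subtypeVal (α.2.1 w w.2)
  have hα't : IsOfType p (q + 1) α' := α.2.2.2.pullback mdifferentiable_complex_subtype_val
  have hα'c : dolbeaultBar α' = 0 := by
    funext w
    rw [hα'def, dolbeaultBar_pullback_subtypeVal_apply α.2 w, hα0 _ w.2]
    rfl
  have hmem : α' ∈ dolbeaultClosedForms E U p (q + 1) := Submodule.subset_span ⟨hα's, hα't, hα'c⟩
  -- hence `∂̄`-exact
  have hex : α' ∈ dolbeaultExactForms E U p (q + 1) := by
    have h0 : dolbeaultCohomology.mk E U p (q + 1) ⟨α', hmem⟩ = dolbeaultCohomology.mk E U p (q + 1) 0 :=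
      Subsingleton.elim _ _
    rw [dolbeaultCohomology.mk_eq_mk_iff] at h0
    simpa using h0
  obtain ⟨β', hβ', hβ'α⟩ := mem_dolbeaultExactForms_succ_iff.1 hex
  -- extend `β'` by zero
  refine ⟨⟨β'.extendOpens w₀, extendOpens_mem_pqFormsOn hβ'⟩, Subtype.ext (funext fun m ↦ ?_)⟩
  rw [coe_localDbar]
  by_cases hm : m ∈ (U : Set M)
  · rw [MForm.restr_apply_of_mem _ hm]
    have h := dolbeaultBar_pullback_subtypeVal_apply (extendOpens_mem_pqFormsOn (w₀ := w₀) hβ') ⟨m, hm⟩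
    rw [MForm.pullback_subtypeVal_extendOpens, hβ'α] at h
    rw [← h, hα'def]
    ext v
    rw [MForm.pullback_subtypeVal_apply]
    rfl
  · rw [MForm.restr_apply_of_notMem _ hm, α.2.2.1 m hm]

/-! ### Chart sets of convex opens -/

omit [FiniteDimensional ℂ E] [T2Space M] [IsManifold 𝓘(ℂ, E) ω M] [IsManifold 𝓘(ℝ, E) ∞ M] in
/-- The chart set of `C` at `x₀`, as an open subset of `M`. [folklore] -/
def chartOpens (x₀ : M) {C : Set E} (hC : IsOpen C) : Opens M :=
  ⟨chartSet 𝓘(ℝ, E) x₀ C, isOpen_chartSet 𝓘(ℝ, E) x₀ hC⟩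

omit [FiniteDimensional ℂ E] [T2Space M] [IsManifold 𝓘(ℂ, E) ω M] [IsManifold 𝓘(ℝ, E) ∞ M] in
/-- Underlying set of `chartOpens`. [folklore] -/
@[simp]
theorem coe_chartOpens (x₀ : M) {C : Set E} (hC : IsOpen C) :
    ((chartOpens x₀ hC : Opens M) : Set M) = chartSet 𝓘(ℝ, E) x₀ C :=
  rfl

omit [FiniteDimensional ℂ E] [T2Space M] [IsManifold 𝓘(ℂ, E) ω M] [IsManifold 𝓘(ℝ, E) ∞ M] in
/-- Membership in `chartOpens` in terms of `chartAt` (the extended chart of the boundaryless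
model `𝓘(ℝ, E)` is the chart). [folklore] -/
theorem mem_chartOpens_iff (x₀ : M) {C : Set E} (hC : IsOpen C) {m : M} :
    m ∈ chartOpens x₀ hC ↔ m ∈ (chartAt E x₀).source ∧ chartAt E x₀ m ∈ C := by
  change m ∈ chartSet 𝓘(ℝ, E) x₀ C ↔ _
  rw [mem_chartSet_iff, extChartAt_source, extChartAt_coe]
  rfl

omit [T2Space M] in
/-- **A chart set of a convex open set has `H^{p,q+1}_{∂̄} = 0`** as an open submanifold: it is
biholomorphic, through the chart, to the convex open `C ⊆ E` (Voisin (2002), Prop. 2.36 for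
`C`, transported by `subsingleton_dolbeaultCohomology_of_leftInverse`).
[cite: VoisinHodgeI2002, Prop. 2.36] -/
theorem subsingleton_dolbeaultCohomology_chartOpens (x₀ : M) {C : Set E} (hC : IsOpen C)
    (hCc : Convex ℝ C) (hCt : C ⊆ (chartAt E x₀).target) (p q : ℕ) :
    Subsingleton (dolbeaultCohomology E (chartOpens x₀ hC) p (q + 1)) := by
  set U : Opens M := chartOpens x₀ hC with hUdef
  set V : Opens E := ⟨C, hC⟩ with hVdef
  -- the chart and its inverse between `↥U` and `↥V`
  have hmemU : ∀ w : U, (w : M) ∈ (chartAt E x₀).source ∧ chartAt E x₀ w ∈ C := fun w ↦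
    (mem_chartOpens_iff x₀ hC).1 w.2
  let f : U → V := fun w ↦ ⟨chartAt E x₀ w, (hmemU w).2⟩
  have hmemV : ∀ c : V, (chartAt E x₀).symm c ∈ U := fun c ↦ by
    rw [hUdef, mem_chartOpens_iff]
    exact ⟨(chartAt E x₀).map_target (hCt c.2), by rw [(chartAt E x₀).right_inv (hCt c.2)]; exact c.2⟩
  let g : V → U := fun c ↦ ⟨(chartAt E x₀).symm c, hmemV c⟩
  have hgf : LeftInverse g f := fun w ↦ Subtype.ext ((chartAt E x₀).left_inv (hmemU w).1)
  -- smoothness of `f` and `g` in the complex and real structures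
  have hf : ∀ {𝕜 : Type} [NontriviallyNormedField 𝕜] [NormedSpace 𝕜 E] [IsManifold 𝓘(𝕜, E) ∞ M],
      ContMDiff 𝓘(𝕜, E) 𝓘(𝕜, E) ∞ f := by
    intro 𝕜 _ _ _ w
    have h1 : ContMDiffAt 𝓘(𝕜, E) 𝓘(𝕜, E) ∞ (fun w : U ↦ chartAt E x₀ (w : M)) w :=
      contMDiffAt_subtype_iff.2 ((contMDiffOn_chart (I := 𝓘(𝕜, E)) (n := ∞)).contMDiffAt
        ((chartAt E x₀).open_source.mem_nhds (hmemU w).1))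
    exact ((ContMDiffWithinAt.subtypeVal_comp_iff V f univ w).1 h1.contMDiffWithinAt).contMDiffAt univ_mem
  have hg : ∀ {𝕜 : Type} [NontriviallyNormedField 𝕜] [NormedSpace 𝕜 E] [IsManifold 𝓘(𝕜, E) ∞ M],
      ContMDiff 𝓘(𝕜, E) 𝓘(𝕜, E) ∞ g := by
    intro 𝕜 _ _ _ c
    have h1 : ContMDiffAt 𝓘(𝕜, E) 𝓘(𝕜, E) ∞ (fun c : V ↦ (chartAt E x₀).symm (c : E)) c :=
      contMDiffAt_subtype_iff.2 ((contMDiffOn_chart_symm (I := 𝓘(𝕜, E)) (n := ∞)).contMDiffAt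
        ((chartAt E x₀).open_target.mem_nhds (hCt c.2)))
    exact ((ContMDiffWithinAt.subtypeVal_comp_iff U g univ c).1 h1.contMDiffWithinAt).contMDiffAt univ_mem
  haveI : IsManifold 𝓘(ℂ, E) ∞ M := IsManifold.of_le (n := ω) le_top
  have hV : Subsingleton (dolbeaultCohomology E V p (q + 1)) :=
    subsingleton_dolbeaultCohomology_of_convex_holds V hCc p q
  exact subsingleton_dolbeaultCohomology_of_leftInverse
    ((hf (𝕜 := ℂ)).mdifferentiable (by simp)) (hf (𝕜 := ℝ))
    ((hg (𝕜 := ℂ)).mdifferentiable (by simp)) (hg (𝕜 := ℝ)) hgf hV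

/-- **Chart sets of convex opens are `∂̄`-acyclic** (in every bidegree `(p, ≥ 1)`, in the sense of
`IsDolbeaultAcyclic`): the `∂̄`-Poincaré lemma on convex opens of `E` (Voisin (2002), Prop. 2.36 /
Hörmander (1973), Thm. 2.7.8) transported into the complex manifold through a holomorphic chart.
These are the finite intersections of the Leray covers of the Cartan–Serre finiteness theorem
(Griffiths–Harris (1978), p. 45). [cite: VoisinHodgeI2002, Prop. 2.36] -/
theorem isDolbeaultAcyclic_chartSet (x₀ : M) {C : Set E} (hC : IsOpen C) (hCc : Convex ℝ C)
    (hCt : C ⊆ (chartAt E x₀).target) (p : ℕ) :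
    IsDolbeaultAcyclic E M (isOpen_chartSet 𝓘(ℝ, E) x₀ hC) p :=
  isDolbeaultAcyclic_of_subsingleton (U := chartOpens x₀ hC) p fun q ↦
    subsingleton_dolbeaultCohomology_chartOpens x₀ hC hCc hCt p q

end Acyclic

end Literature.Geometry.Kaehler

end
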